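import Summits.KontsevichZagierPeriods.KontsevichZagierPeriods.Theorems.RootDecompQuadraticDescentDarkPairsEleven

/-!
# Route RootDecompQuadraticDescent (node F′) — census dark pairs of weight two DECIDED by moves — part 2/2 (`…DarkPairs`): census pairs #14 and #9 and the four pairs as DECIDED INSTANCES of the route items (`darkPairs_decided`, `darkPairs_descentTwoQ_instances`, `darkPairs_of_kzDimTwo`)

Theorems-split (2 files ≤ 400 lines) of the decomp-kz lens-6 gen-6 file `run/shared/lean/pub/decomp-kz/decomp-kz-lens-6/g6/RootDecompQuadraticDescentDarkPairs.lean`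
(@95ee4a45, 650 lines; lens farm rc 0 / 0 sorry / standard axioms; critic decomp-kz-crit-1 g2 CLEARED 2026-08-30T06:42:55Z; landing ask L12 of the writer),
landed by the census seat decomp-kz-census-1 g6 (--supports stmt-KontsevichZagierPeriods-28994). FOUR census-dark weight-2 pairs of the HQ = 2 box
(census decomp-kz K-M2-DARK #9, #11, #13, #14, all of ratio 1 : 2) are proved CONGRUENT in `KZ.relations` by explicit 3–4-move chains using rules (1) and (2)
only (fold + central symmetry `Q(1−x,1−y)` + subdivision), hence are DECIDED instances of `DescentTwoQ` (item 28994) and of `KZDimTwo` (item 4280) with no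
use of the oracle hypotheses. The reflection move `xᵢ ↦ 1 − xᵢ` of `Theorems/HermiteRigidityIslandComplementCubeReflection.lean` (module unbuilt on the
farm today) is carried as file-local copies. [Kontsevich–Zagier 2001 §1.2] Standard axioms, 0 sorry, no new instances, no notation.
-/

noncomputable section

set_option linter.dupNamespace false

open MeasureTheory Set MvPolynomial

namespace Summit.KontsevichZagierPeriods.RootDecompQuadraticDescent.DarkPairs

open Literature.NumberTheory.Transcendental
open Literature.NumberTheory.Transcendental.KZ
open Literature.ModelTheory.ExponentialFields (IsSemialgebraic)
open Summit.KontsevichZagierPeriods.KontsevichZagierPeriods.Theses.RootDecompQuadraticDescent (KZDimTwo DescentTwoQ)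

/-- Helper (theorem) `reflect_reflect` of the dark-pairs chains (census pairs #9/#11/#13/#14 decided by KZ rules 1+2; lens-6 g6). -/
private theorem reflect_reflect {M : ℕ} (i : Fin M) (x : Fin M → ℝ) :
    Function.update (Function.update x i (1 - x i)) i
        (1 - Function.update x i (1 - x i) i) = x := by
  funext j
  rcases eq_or_ne j i with rfl | hj
  · simp
  · simp [Function.update_of_ne hj]

/-- Helper (theorem) `image_reflect_cube` of the dark-pairs chains (census pairs #9/#11/#13/#14 decided by KZ rules 1+2; lens-6 g6). -/
private theorem image_reflect_cube {M : ℕ} (i : Fin M) :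
    (fun x : Fin M → ℝ => Function.update x i (1 - x i)) '' cube M = cube M := by
  refine Subset.antisymm ?_ fun y hy => ?_
  · rintro _ ⟨x, hx, rfl⟩
    exact KZ.update_mem_cube hx i (by linarith [(hx i).2]) (by linarith [(hx i).1])
  · refine ⟨Function.update y i (1 - y i),
      KZ.update_mem_cube hy i (by linarith [(hy i).2]) (by linarith [(hy i).1]), ?_⟩
    exact reflect_reflect i y

/-- Helper (theorem) `reflectDeriv_apply` of the dark-pairs chains (census pairs #9/#11/#13/#14 decided by KZ rules 1+2; lens-6 g6). -/
private theorem reflectDeriv_apply {M : ℕ} (i : Fin M) (v : Fin M → ℝ) (j : Fin M) :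
    ((ContinuousLinearMap.id ℝ (Fin M → ℝ) -
        ((2:ℝ) • ContinuousLinearMap.proj (R := ℝ) (φ := fun _ : Fin M => ℝ) i).smulRight
          (Pi.single i (1:ℝ) : Fin M → ℝ) : (Fin M → ℝ) →L[ℝ] (Fin M → ℝ))) v j = if j = i then -v i else v j := by
  simp only [sub_apply, ContinuousLinearMap.id_apply, ContinuousLinearMap.smulRight_apply,
    smul_apply, ContinuousLinearMap.proj_apply, Pi.sub_apply, Pi.smul_apply, smul_eq_mul,
    Pi.single_apply, mul_ite, mul_one, mul_zero]
  split_ifs with hj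
  · subst hj; ring
  · ring

/-- Helper (theorem) `abs_det_reflectDeriv` of the dark-pairs chains (census pairs #9/#11/#13/#14 decided by KZ rules 1+2; lens-6 g6). -/
private theorem abs_det_reflectDeriv {M : ℕ} (i : Fin M) :
    |((ContinuousLinearMap.id ℝ (Fin M → ℝ) -
        ((2:ℝ) • ContinuousLinearMap.proj (R := ℝ) (φ := fun _ : Fin M => ℝ) i).smulRight
          (Pi.single i (1:ℝ) : Fin M → ℝ) : (Fin M → ℝ) →L[ℝ] (Fin M → ℝ))).det| = 1 := by
  set L := (ContinuousLinearMap.id ℝ (Fin M → ℝ) -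
    ((2:ℝ) • ContinuousLinearMap.proj (R := ℝ) (φ := fun _ : Fin M => ℝ) i).smulRight
      (Pi.single i (1:ℝ) : Fin M → ℝ) : (Fin M → ℝ) →L[ℝ] (Fin M → ℝ)) with hL
  have hinv : (L : (Fin M → ℝ) →ₗ[ℝ] (Fin M → ℝ)).comp (L : (Fin M → ℝ) →ₗ[ℝ] (Fin M → ℝ)) =
      LinearMap.id := by
    refine LinearMap.ext fun v => funext fun j => ?_
    rw [LinearMap.comp_apply, ContinuousLinearMap.coe_coe, LinearMap.id_apply, hL,
      reflectDeriv_apply, reflectDeriv_apply]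
    rcases eq_or_ne j i with rfl | hj
    · simp
    · simp [hj]
  have h := congrArg LinearMap.det hinv
  rw [LinearMap.det_comp, LinearMap.det_id] at h
  rw [ContinuousLinearMap.det]
  rcases mul_self_eq_one_iff.mp h with h1 | h1 <;> simp [h1]

/-- Helper (theorem) `hasFDerivAt_reflect` of the dark-pairs chains (census pairs #9/#11/#13/#14 decided by KZ rules 1+2; lens-6 g6). -/
private theorem hasFDerivAt_reflect {M : ℕ} (i : Fin M) (x : Fin M → ℝ) :
    HasFDerivAt (fun y : Fin M → ℝ => Function.update y i (1 - y i))
      ((ContinuousLinearMap.id ℝ (Fin M → ℝ) -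
        ((2:ℝ) • ContinuousLinearMap.proj (R := ℝ) (φ := fun _ : Fin M => ℝ) i).smulRight
          (Pi.single i (1:ℝ) : Fin M → ℝ) : (Fin M → ℝ) →L[ℝ] (Fin M → ℝ))) x := by
  have h0 : HasFDerivAt (fun y : Fin M → ℝ => 2 * y i - 1)
      ((2:ℝ) • ContinuousLinearMap.proj (R := ℝ) (φ := fun _ : Fin M => ℝ) i) x :=
    ((hasFDerivAt_apply i x).const_mul (2:ℝ)).sub_const 1
  have h1 := (hasFDerivAt_id x).sub (h0.smul_const (Pi.single i (1:ℝ)))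
  refine h1.congr_of_eventuallyEq (Filter.Eventually.of_forall fun y => ?_)
  funext j
  simp only [Pi.sub_apply, id_eq, Pi.smul_apply, Pi.single_apply, smul_eq_mul, mul_ite, mul_one,
    mul_zero, Function.update_apply]
  split_ifs with hj
  · subst hj; ring
  · ring

/-- Helper (theorem) `isSemialgebraicMapOn_reflect` of the dark-pairs chains (census pairs #9/#11/#13/#14 decided by KZ rules 1+2; lens-6 g6). -/
private theorem isSemialgebraicMapOn_reflect {M : ℕ} (i : Fin M) :
    IsSemialgebraicMapOn ℚ (cube M) (fun y : Fin M → ℝ => Function.update y i (1 - y i)) := by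
  refine (isSemialgebraicMapOn_aeval isSemialgebraic_cube
    (Function.update (fun j => (X j : MvPolynomial (Fin M) ℚ)) i (1 - X i))).congr fun x _ => ?_
  funext j
  rcases eq_or_ne j i with rfl | hj
  · simp
  · simp [Function.update_of_ne hj]

/-- **The reflection move for regular rational functions**: `S(x) = T(x with xᵢ := 1 − xᵢ)` on the
cube gives `[□ᴹ, S] − [□ᴹ, T] ∈ KZ.relations`. [cite: KontsevichZagier2001, §1.2 rule (2)] -/
private theorem rel_reflect {M : ℕ} (i : Fin M) (T S : RFun M)
    (h : ∀ x ∈ cube M, S.fn x = T.fn (Function.update x i (1 - x i))) :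
    KZ.of S.rep - KZ.of T.rep ∈ KZ.relations :=
  rel_reflect_rep M i S.rep T.rep S.isTameCube_rep T.isTameCube_rep h

/-- Helper (theorem) `update_zero_apply_one` of the dark-pairs chains (census pairs #9/#11/#13/#14 decided by KZ rules 1+2; lens-6 g6). -/
@[simp] private theorem update_zero_apply_one (x : Fin 2 → ℝ) (a : ℝ) : Function.update x 0 a 1 = x 1 :=
  Function.update_of_ne (by decide) a x

/-- A regular rational function gives a KZ-rational representation. [folklore] -/
private theorem isRational_rep {M : ℕ} (T : RFun M) : T.rep.IsRational :=
  ⟨T.num, T.den, T.den_ne, fun _ _ => rfl⟩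

/-- `Q_A = 1 + y + x² − 2xy`. -/
def QA14 : MvPolynomial (Fin 2) ℚ := 1 + X 1 + X 0 ^ 2 - 2 * X 0 * X 1

/-- `Q_B = 2 + y + 2x² − 2xy = 2·Q_A(x, y/2)` (so the lower half-piece IS `B`). -/
def QB14 : MvPolynomial (Fin 2) ℚ := 2 + X 1 + 2 * X 0 ^ 2 - 2 * X 0 * X 1

/-- `2·Q_A(x, (1+y)/2)`. -/
def QU14 : MvPolynomial (Fin 2) ℚ := 3 - 2 * X 0 + X 1 + 2 * X 0 ^ 2 - 2 * X 0 * X 1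

/-- `2·Q_A(x, (2−y)/2)` (the upper half-piece reflected in `y`). -/
def QC14 : MvPolynomial (Fin 2) ℚ := 4 - 4 * X 0 - X 1 + 2 * X 0 ^ 2 + 2 * X 0 * X 1

/-- Helper (theorem) `QA14_pos` of the dark-pairs chains (census pairs #9/#11/#13/#14 decided by KZ rules 1+2; lens-6 g6). -/
theorem QA14_pos {x : Fin 2 → ℝ} (hx : x ∈ cube 2) : 0 < aeval x QA14 := by
  obtain ⟨h0l, h0u⟩ := hx 0; obtain ⟨h1l, h1u⟩ := hx 1
  simp only [QA14, map_add, map_sub, map_mul, map_pow, map_one, map_ofNat, aeval_X]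
  nlinarith [sq_nonneg (x 0 - x 1), mul_nonneg h1l (sub_nonneg.2 h1u)]

/-- Helper (theorem) `QB14_pos` of the dark-pairs chains (census pairs #9/#11/#13/#14 decided by KZ rules 1+2; lens-6 g6). -/
theorem QB14_pos {x : Fin 2 → ℝ} (hx : x ∈ cube 2) : 0 < aeval x QB14 := by
  obtain ⟨h0l, h0u⟩ := hx 0; obtain ⟨h1l, h1u⟩ := hx 1
  simp only [QB14, map_add, map_sub, map_mul, map_pow, map_ofNat, aeval_X]
  nlinarith [sq_nonneg (x 0 - x 1 / 2), mul_nonneg h1l (sub_nonneg.2 h1u)]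

/-- Helper (theorem) `QU14_pos` of the dark-pairs chains (census pairs #9/#11/#13/#14 decided by KZ rules 1+2; lens-6 g6). -/
theorem QU14_pos {x : Fin 2 → ℝ} (hx : x ∈ cube 2) : 0 < aeval x QU14 := by
  obtain ⟨h0l, h0u⟩ := hx 0; obtain ⟨h1l, h1u⟩ := hx 1
  simp only [QU14, map_add, map_sub, map_mul, map_pow, map_ofNat, aeval_X]
  nlinarith [sq_nonneg (x 0 - (1 + x 1) / 2), mul_nonneg h1l (sub_nonneg.2 h1u)]

/-- Helper (theorem) `QC14_pos` of the dark-pairs chains (census pairs #9/#11/#13/#14 decided by KZ rules 1+2; lens-6 g6). -/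
theorem QC14_pos {x : Fin 2 → ℝ} (hx : x ∈ cube 2) : 0 < aeval x QC14 := by
  obtain ⟨h0l, h0u⟩ := hx 0; obtain ⟨h1l, h1u⟩ := hx 1
  simp only [QC14, map_add, map_sub, map_mul, map_pow, map_ofNat, aeval_X]
  nlinarith [sq_nonneg (x 0 - (2 - x 1) / 2), mul_nonneg h1l (sub_nonneg.2 h1u)]

/-- `A = [□², 1/Q_A]`. -/
def A14 : RFun 2 := ⟨1, QA14, fun _ hx => (QA14_pos hx).ne'⟩

/-- `B = [□², 1/Q_B]` (= the lower half-piece of the fold of `A` along `y`). -/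
def B14 : RFun 2 := ⟨1, QB14, fun _ hx => (QB14_pos hx).ne'⟩

/-- `[□², 2/Q_B]`. -/
def B14two : RFun 2 := ⟨2, QB14, fun _ hx => (QB14_pos hx).ne'⟩

/-- upper half-piece. -/
def U14 : RFun 2 := ⟨1, QU14, fun _ hx => (QU14_pos hx).ne'⟩

/-- upper half-piece reflected in `y`. -/
def C14 : RFun 2 := ⟨1, QC14, fun _ hx => (QC14_pos hx).ne'⟩

/-- Helper (theorem) `A14_subdiv` of the dark-pairs chains (census pairs #9/#11/#13/#14 decided by KZ rules 1+2; lens-6 g6). -/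
theorem A14_subdiv : KZ.of A14.rep - KZ.of B14.rep - KZ.of U14.rep ∈ KZ.relations := by
  refine rel_subdiv 1 A14 B14 U14 (fun x _ => ?_) (fun x _ => ?_)
  · simp only [A14, B14, RFun.fn, QA14, QB14, map_add, map_sub, map_mul, map_pow, map_one, map_ofNat,
      aeval_X, Function.update_self, update_one_apply_zero]
    exact one_div_eq_mul_one_div (by norm_num) (by ring)
  · simp only [A14, U14, RFun.fn, QA14, QU14, map_add, map_sub, map_mul, map_pow, map_one, map_ofNat,
      aeval_X, Function.update_self, update_one_apply_zero]
    exact one_div_eq_mul_one_div (by norm_num) (by ring)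

/-- Helper (theorem) `C14_U14` of the dark-pairs chains (census pairs #9/#11/#13/#14 decided by KZ rules 1+2; lens-6 g6). -/
theorem C14_U14 : KZ.of C14.rep - KZ.of U14.rep ∈ KZ.relations := by
  refine rel_reflect 1 U14 C14 fun x _ => ?_
  simp only [C14, U14, RFun.fn, QC14, QU14, map_add, map_sub, map_mul, map_pow, map_one, map_ofNat,
    aeval_X, Function.update_self, update_one_apply_zero]
  congr 1; ring

/-- Helper (theorem) `B14_C14` of the dark-pairs chains (census pairs #9/#11/#13/#14 decided by KZ rules 1+2; lens-6 g6). -/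
theorem B14_C14 : KZ.of B14.rep - KZ.of C14.rep ∈ KZ.relations := by
  refine rel_reflect 0 C14 B14 fun x _ => ?_
  simp only [B14, C14, RFun.fn, QB14, QC14, map_add, map_sub, map_mul, map_pow, map_one, map_ofNat,
    aeval_X, Function.update_self, update_zero_apply_one]
  congr 1; ring

/-- **Census pair #14 decided**: `[□², 1/(1+y+x²−2xy)] − 2·[□², 1/(2+y+2x²−2xy)] ∈ KZ.relations`. -/
theorem pair14 : KZ.of A14.rep - 2 • KZ.of B14.rep ∈ KZ.relations := by
  have : KZ.of A14.rep - 2 • KZ.of B14.rep = (KZ.of A14.rep - KZ.of B14.rep - KZ.of U14.rep)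
      - (KZ.of B14.rep - KZ.of C14.rep) - (KZ.of C14.rep - KZ.of U14.rep) := by abel
  rw [this]
  exact KZ.relations.sub_mem (KZ.relations.sub_mem A14_subdiv B14_C14) C14_U14

/-- Helper (theorem) `pair14_equivalent` of the dark-pairs chains (census pairs #9/#11/#13/#14 decided by KZ rules 1+2; lens-6 g6). -/
theorem pair14_equivalent : KZ.Equivalent A14.rep B14two.rep := by
  have h2 := rel_double B14 B14two fun x _ => by
    simp only [B14, B14two, RFun.fn, map_one, map_ofNat]; ring
  have : KZ.of A14.rep - KZ.of B14two.rep =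
      (KZ.of A14.rep - 2 • KZ.of B14.rep) - (KZ.of B14two.rep - 2 • KZ.of B14.rep) := by abel
  show KZ.of A14.rep - KZ.of B14two.rep ∈ KZ.relations
  rw [this]
  exact KZ.relations.sub_mem pair14 h2

/-- Helper (theorem) `pair14_value` of the dark-pairs chains (census pairs #9/#11/#13/#14 decided by KZ rules 1+2; lens-6 g6). -/
theorem pair14_value : A14.rep.value = B14two.rep.value :=
  KZ.Equivalent.value_eq_holds pair14_equivalent

/-- `Q_A = 1 − x + 2x² − 2xy + y²`. -/
def QA9 : MvPolynomial (Fin 2) ℚ := 1 - X 0 + 2 * X 0 ^ 2 - 2 * X 0 * X 1 + X 1 ^ 2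

/-- `Q_A` with the variables swapped: `1 − y + x² − 2xy + 2y²`. -/
def QS9 : MvPolynomial (Fin 2) ℚ := 1 - X 1 + X 0 ^ 2 - 2 * X 0 * X 1 + 2 * X 1 ^ 2

/-- `Q_B = 2 − 2x − y + 2x² + 2xy + y² = 2·Q_A((1−y)/2, x)`. -/
def QB9 : MvPolynomial (Fin 2) ℚ := 2 - 2 * X 0 - X 1 + 2 * X 0 ^ 2 + 2 * X 0 * X 1 + X 1 ^ 2

/-- `2·Q_S(x, y/2)`. -/
def QL9 : MvPolynomial (Fin 2) ℚ := 2 - X 1 + 2 * X 0 ^ 2 - 2 * X 0 * X 1 + X 1 ^ 2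

/-- `2·Q_S(x, (1+y)/2)`. -/
def QU9 : MvPolynomial (Fin 2) ℚ := 2 - 2 * X 0 + X 1 + 2 * X 0 ^ 2 - 2 * X 0 * X 1 + X 1 ^ 2

/-- Helper (theorem) `QA9_pos` of the dark-pairs chains (census pairs #9/#11/#13/#14 decided by KZ rules 1+2; lens-6 g6). -/
theorem QA9_pos {x : Fin 2 → ℝ} (hx : x ∈ cube 2) : 0 < aeval x QA9 := by
  obtain ⟨h0l, h0u⟩ := hx 0; obtain ⟨h1l, h1u⟩ := hx 1
  simp only [QA9, map_add, map_sub, map_mul, map_pow, map_one, map_ofNat, aeval_X]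
  nlinarith [sq_nonneg (x 0 - x 1), sq_nonneg (x 0 - 1 / 2)]

/-- Helper (theorem) `QS9_pos` of the dark-pairs chains (census pairs #9/#11/#13/#14 decided by KZ rules 1+2; lens-6 g6). -/
theorem QS9_pos {x : Fin 2 → ℝ} (hx : x ∈ cube 2) : 0 < aeval x QS9 := by
  obtain ⟨h0l, h0u⟩ := hx 0; obtain ⟨h1l, h1u⟩ := hx 1
  simp only [QS9, map_add, map_sub, map_mul, map_pow, map_one, map_ofNat, aeval_X]
  nlinarith [sq_nonneg (x 0 - x 1), sq_nonneg (x 1 - 1 / 2)]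

/-- Helper (theorem) `QB9_pos` of the dark-pairs chains (census pairs #9/#11/#13/#14 decided by KZ rules 1+2; lens-6 g6). -/
theorem QB9_pos {x : Fin 2 → ℝ} (hx : x ∈ cube 2) : 0 < aeval x QB9 := by
  obtain ⟨h0l, h0u⟩ := hx 0; obtain ⟨h1l, h1u⟩ := hx 1
  simp only [QB9, map_add, map_sub, map_mul, map_pow, map_ofNat, aeval_X]
  nlinarith [sq_nonneg (x 1 + x 0 - 1 / 2), sq_nonneg (x 0 - 1 / 2)]

/-- Helper (theorem) `QL9_pos` of the dark-pairs chains (census pairs #9/#11/#13/#14 decided by KZ rules 1+2; lens-6 g6). -/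
theorem QL9_pos {x : Fin 2 → ℝ} (hx : x ∈ cube 2) : 0 < aeval x QL9 := by
  obtain ⟨h0l, h0u⟩ := hx 0; obtain ⟨h1l, h1u⟩ := hx 1
  simp only [QL9, map_add, map_sub, map_mul, map_pow, map_ofNat, aeval_X]
  nlinarith [sq_nonneg (x 0 - x 1 / 2), sq_nonneg (x 1 - 1)]

/-- Helper (theorem) `QU9_pos` of the dark-pairs chains (census pairs #9/#11/#13/#14 decided by KZ rules 1+2; lens-6 g6). -/
theorem QU9_pos {x : Fin 2 → ℝ} (hx : x ∈ cube 2) : 0 < aeval x QU9 := by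
  obtain ⟨h0l, h0u⟩ := hx 0; obtain ⟨h1l, h1u⟩ := hx 1
  simp only [QU9, map_add, map_sub, map_mul, map_pow, map_ofNat, aeval_X]
  nlinarith [sq_nonneg (x 0 - (1 + x 1) / 2), sq_nonneg (x 1)]

/-- `A = [□², 1/Q_A]`. -/
def A9 : RFun 2 := ⟨1, QA9, fun _ hx => (QA9_pos hx).ne'⟩

/-- `A` with the variables swapped. -/
def S9 : RFun 2 := ⟨1, QS9, fun _ hx => (QS9_pos hx).ne'⟩

/-- `B = [□², 1/Q_B]`. -/
def B9 : RFun 2 := ⟨1, QB9, fun _ hx => (QB9_pos hx).ne'⟩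

/-- `[□², 2/Q_B]`. -/
def B9two : RFun 2 := ⟨2, QB9, fun _ hx => (QB9_pos hx).ne'⟩

/-- lower half-piece of `S` along `y`. -/
def L9 : RFun 2 := ⟨1, QL9, fun _ hx => (QL9_pos hx).ne'⟩

/-- upper half-piece of `S` along `y`. -/
def U9 : RFun 2 := ⟨1, QU9, fun _ hx => (QU9_pos hx).ne'⟩

/-- Move 0 (rule 2, a permutation of the coordinates): `[A] ≡ [S]`. -/
theorem A9_S9 : KZ.of A9.rep - KZ.of S9.rep ∈ KZ.relations := by
  have h1 := RFun.rel_rename A9 (Equiv.swap (0 : Fin 2) 1)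
  have h2 : KZ.of (A9.rename (Equiv.swap (0 : Fin 2) 1)).rep - KZ.of S9.rep ∈ KZ.relations := by
    refine RFun.rel_of_eqOn fun x _ => ?_
    rw [RFun.fn_rename]
    simp only [A9, S9, RFun.fn, QA9, QS9, map_add, map_sub, map_mul, map_pow, map_one, map_ofNat,
      aeval_X, Function.comp_apply, Equiv.swap_apply_left, Equiv.swap_apply_right]
    congr 1; ring
  have : KZ.of A9.rep - KZ.of S9.rep = (KZ.of A9.rep - KZ.of (A9.rename (Equiv.swap (0 : Fin 2) 1)).rep)
      + (KZ.of (A9.rename (Equiv.swap (0 : Fin 2) 1)).rep - KZ.of S9.rep) := by abel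
  rw [this]
  exact KZ.relations.add_mem h1 h2

/-- Helper (theorem) `S9_subdiv` of the dark-pairs chains (census pairs #9/#11/#13/#14 decided by KZ rules 1+2; lens-6 g6). -/
theorem S9_subdiv : KZ.of S9.rep - KZ.of L9.rep - KZ.of U9.rep ∈ KZ.relations := by
  refine rel_subdiv 1 S9 L9 U9 (fun x _ => ?_) (fun x _ => ?_)
  · simp only [S9, L9, RFun.fn, QS9, QL9, map_add, map_sub, map_mul, map_pow, map_one, map_ofNat,
      aeval_X, Function.update_self, update_one_apply_zero]
    exact one_div_eq_mul_one_div (by norm_num) (by ring)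
  · simp only [S9, U9, RFun.fn, QS9, QU9, map_add, map_sub, map_mul, map_pow, map_one, map_ofNat,
      aeval_X, Function.update_self, update_one_apply_zero]
    exact one_div_eq_mul_one_div (by norm_num) (by ring)

/-- Helper (theorem) `B9_L9` of the dark-pairs chains (census pairs #9/#11/#13/#14 decided by KZ rules 1+2; lens-6 g6). -/
theorem B9_L9 : KZ.of B9.rep - KZ.of L9.rep ∈ KZ.relations := by
  refine rel_reflect 1 L9 B9 fun x _ => ?_
  simp only [B9, L9, RFun.fn, QB9, QL9, map_add, map_sub, map_mul, map_pow, map_one, map_ofNat,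
    aeval_X, Function.update_self, update_one_apply_zero]
  congr 1; ring

/-- Helper (theorem) `B9_U9` of the dark-pairs chains (census pairs #9/#11/#13/#14 decided by KZ rules 1+2; lens-6 g6). -/
theorem B9_U9 : KZ.of B9.rep - KZ.of U9.rep ∈ KZ.relations := by
  refine rel_reflect 0 U9 B9 fun x _ => ?_
  simp only [B9, U9, RFun.fn, QB9, QU9, map_add, map_sub, map_mul, map_pow, map_one, map_ofNat,
    aeval_X, Function.update_self, update_zero_apply_one]
  congr 1; ring

/-- **Census pair #9 decided**:
`[□², 1/(1−x+2x²−2xy+y²)] − 2·[□², 1/(2−2x−y+2x²+2xy+y²)] ∈ KZ.relations`. -/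
theorem pair9 : KZ.of A9.rep - 2 • KZ.of B9.rep ∈ KZ.relations := by
  have : KZ.of A9.rep - 2 • KZ.of B9.rep =
      (KZ.of A9.rep - KZ.of S9.rep) + (KZ.of S9.rep - 2 • KZ.of B9.rep) := by abel
  rw [this]
  exact KZ.relations.add_mem A9_S9 (rel_fold S9 B9 L9 U9 S9_subdiv B9_L9 B9_U9)

/-- Helper (theorem) `pair9_equivalent` of the dark-pairs chains (census pairs #9/#11/#13/#14 decided by KZ rules 1+2; lens-6 g6). -/
theorem pair9_equivalent : KZ.Equivalent A9.rep B9two.rep := by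
  have h2 := rel_double B9 B9two fun x _ => by
    simp only [B9, B9two, RFun.fn, map_one, map_ofNat]; ring
  have : KZ.of A9.rep - KZ.of B9two.rep =
      (KZ.of A9.rep - 2 • KZ.of B9.rep) - (KZ.of B9two.rep - 2 • KZ.of B9.rep) := by abel
  show KZ.of A9.rep - KZ.of B9two.rep ∈ KZ.relations
  rw [this]
  exact KZ.relations.sub_mem pair9 h2

/-- Helper (theorem) `pair9_value` of the dark-pairs chains (census pairs #9/#11/#13/#14 decided by KZ rules 1+2; lens-6 g6). -/
theorem pair9_value : A9.rep.value = B9two.rep.value :=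
  KZ.Equivalent.value_eq_holds pair9_equivalent

/-- The four equal-valued pairs of two-dimensional KZ-rational representations on the closed square
`([□², 1/Q_A], [□², 2/Q_B])` (census K-M2-DARK pairs #9, #11, #13, #14, all typed «UNEXPLAINED by
folds» there) satisfy the conclusion of `KZDimTwo` (item 4280) ABSOLUTELY — hence the conclusion of
`DescentTwoQ` (item 28994) modulo every `R ⊇ KZ.relations`, whatever the oracle. -/
theorem darkPairs_decided :
    (A9.rep.IsRational ∧ B9two.rep.IsRational ∧ A9.rep.value = B9two.rep.value ∧
      KZ.Equivalent A9.rep B9two.rep) ∧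
    (A11.rep.IsRational ∧ B11two.rep.IsRational ∧ A11.rep.value = B11two.rep.value ∧
      KZ.Equivalent A11.rep B11two.rep) ∧
    (A13.rep.IsRational ∧ B13two.rep.IsRational ∧ A13.rep.value = B13two.rep.value ∧
      KZ.Equivalent A13.rep B13two.rep) ∧
    (A14.rep.IsRational ∧ B14two.rep.IsRational ∧ A14.rep.value = B14two.rep.value ∧
      KZ.Equivalent A14.rep B14two.rep) :=
  ⟨⟨isRational_rep _, isRational_rep _, pair9_value, pair9_equivalent⟩,
   ⟨isRational_rep _, isRational_rep _, pair11_value, pair11_equivalent⟩,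
   ⟨isRational_rep _, isRational_rep _, pair13_value, pair13_equivalent⟩,
   ⟨isRational_rep _, isRational_rep _, pair14_value, pair14_equivalent⟩⟩

/-- Relative form: the four differences lie in every additive subgroup `R ⊇ KZ.relations` — the
instances of the conclusion of `DescentTwoQ` (item 28994) at these pairs hold with NO use of its
oracle hypotheses (i), (ii). -/
theorem darkPairs_descentTwoQ_instances (R : AddSubgroup KZ.FormalRep) (hR : KZ.relations ≤ R) :
    KZ.of A9.rep - KZ.of B9two.rep ∈ R ∧ KZ.of A11.rep - KZ.of B11two.rep ∈ R ∧
    KZ.of A13.rep - KZ.of B13two.rep ∈ R ∧ KZ.of A14.rep - KZ.of B14two.rep ∈ R :=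
  ⟨hR pair9_equivalent, hR pair11_equivalent, hR pair13_equivalent, hR pair14_equivalent⟩

/-- Sanity link to the route: `KZDimTwo` (item 4280) of course also yields these four congruences
(its instances at `n = m = 2`); the point of this file is that they hold unconditionally. -/
theorem darkPairs_of_kzDimTwo (h : KZDimTwo) :
    KZ.Equivalent A9.rep B9two.rep ∧ KZ.Equivalent A11.rep B11two.rep ∧
    KZ.Equivalent A13.rep B13two.rep ∧ KZ.Equivalent A14.rep B14two.rep :=
  ⟨h le_rfl le_rfl _ _ (isRational_rep _) (isRational_rep _) pair9_value,
   h le_rfl le_rfl _ _ (isRational_rep _) (isRational_rep _) pair11_value,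
   h le_rfl le_rfl _ _ (isRational_rep _) (isRational_rep _) pair13_value,
   h le_rfl le_rfl _ _ (isRational_rep _) (isRational_rep _) pair14_value⟩

end Summit.KontsevichZagierPeriods.RootDecompQuadraticDescent.DarkPairs
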